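import Literature.NumberTheory.LFunctions.RiemannSiegelStirling
import HarnessLib

/-!
# Kadiri's bounds for `Re Γ'/Γ` and for `Δ₁ = T₁(s) − κ T₁(s + δ)` (Acta Arith. 117 (2005), Lemma 3.5, Lemma 4.5)

Topic `Literature/NumberTheory/LFunctions`. Everything in this file is PROVED (no named fact, no
definition). In Kadiri's method for the classical zero-free region (and in Mossinghoff–Trudgian 2015,
Mossinghoff–Trudgian–Yang 2024 §9, the tree's named fact
`zero_free_region_mossinghoff_trudgian_yang_large_height`) the Gamma term of the explicit formula is
`f(0) T₁(s)`, `T₁(s) = −½ log π + ½ Re Γ'/Γ(s/2 + 1)` (Prop. 2.1), and Prop. 2.2 / Lemma 4.5 bound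
`Δ₁(s) = T₁(s) − κ T₁(s + δ)` at `s = σ + ikγ₀`:

* `k ≥ 1`: `Δ₁(σ + it) ≤ ((1−κ)/2) log t − ((1−κ)/2) log(2π) + ½ r` with an explicit `r = O(1/t²)`
  (Kadiri Lemma 3.5, case `|y| ≥ y₀`, with her admissible error `r₃`; here from the tree's
  second-order Stirling bound `|Re ψ(w) − log‖w‖ + Re 1/(2w)| ≤ 1/(6|Im w|³) + π/(12 (Im w)²)`,
  `Literature.NumberTheory.LFunctions.Complex.abs_re_digamma_sub_log_norm_add_re_le`, which gives the
  smaller error `r(x, y) = x²/(2y²) + (1+κ)(4/(3y³) + π/(3y²))` under Kadiri's side condition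
  `κ ≤ x/(x+δ)`);
* `k = 0`: `Δ₁(σ) ≤ −((1−κ)/2) log π + ½ ψ(3/2) − (κ/2) ψ((σ₀+δ)/2 + 1)` for `σ₀ ≤ σ ≤ 1`
  (Kadiri Lemma 4.5, `c₁(0)`: "grâce à la croissance de `Re Γ'/Γ` sur `[0, +∞[`"), from the
  monotonicity of `ψ` on `(0, ∞)` (`re_digamma_ofReal_mono`, via the series
  `ψ(w) + γ = Σ (1/(k+1) − 1/(w+k))` of the tree).

## References

* H. Kadiri, *Une région explicite sans zéros pour la fonction ζ de Riemann*, Acta Arith. 117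
  (2005) = arXiv:math/0401238, Lemma 3.5 and (Gamma3), Lemma 4.5, (55)–(56). (`Kadiri2005`)
* M. J. Mossinghoff, T. S. Trudgian, J. Number Theory 157 (2015) = arXiv:1410.3926, §4
  (`C₁(η)`, `c₁(k)`, `r₂`, `r₃`). (`MossinghoffTrudgian2015`)
-/

noncomputable section

open Complex Real

namespace Literature.NumberTheory.LFunctions

namespace KadiriDigamma

/-! ## `Re ψ(X + iY)` against `log Y` -/

/-- `log Y ≤ log ‖X+iY‖ ≤ log Y + X²/(2Y²)` and `Re 1/(2(X+iY)) = X/(2(X²+Y²))` (`X, Y > 0`).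
[folklore] -/
theorem log_norm_bounds {X Y : ℝ} (hX : 0 < X) (hY : 0 < Y) :
    Real.log Y ≤ Real.log ‖(X : ℂ) + Y * I‖ ∧
      Real.log ‖(X : ℂ) + Y * I‖ ≤ Real.log Y + X ^ 2 / (2 * Y ^ 2) ∧
      (1 / (2 * ((X : ℂ) + Y * I))).re = X / (2 * (X ^ 2 + Y ^ 2)) := by
  set w : ℂ := (X : ℂ) + Y * I with hw
  have hwre : w.re = X := by simp [hw]
  have hwim : w.im = Y := by simp [hw]
  have hn2 : ‖w‖ ^ 2 = X ^ 2 + Y ^ 2 := by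
    rw [Complex.sq_norm, Complex.normSq_apply, hwre, hwim]; ring
  have hnpos : 0 < ‖w‖ := norm_pos_iff.2 fun h ↦ by
    have := congrArg Complex.im h; rw [hwim] at this; simp at this; linarith
  have hlog2 : 2 * Real.log ‖w‖ = Real.log (X ^ 2 + Y ^ 2) := by
    rw [← hn2, Real.log_pow]; norm_num
  have hlogY : 2 * Real.log Y = Real.log (Y ^ 2) := by rw [Real.log_pow]; norm_num
  refine ⟨?_, ?_, ?_⟩
  · have : Real.log (Y ^ 2) ≤ Real.log (X ^ 2 + Y ^ 2) :=
      Real.log_le_log (by positivity) (by nlinarith)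
    linarith
  · have h1 : Real.log (X ^ 2 + Y ^ 2) - Real.log (Y ^ 2) ≤ X ^ 2 / Y ^ 2 := by
      rw [← Real.log_div (by positivity) (by positivity)]
      have hq : (X ^ 2 + Y ^ 2) / Y ^ 2 = 1 + X ^ 2 / Y ^ 2 := by field_simp; ring
      rw [hq]
      exact (Real.log_le_sub_one_of_pos (by positivity)).trans (by linarith)
    have : X ^ 2 / (2 * Y ^ 2) = (X ^ 2 / Y ^ 2) / 2 := by ring
    rw [this]
    linarith
  · have hw0 : w ≠ 0 := norm_pos_iff.1 hnpos
    rw [one_div, mul_inv, Complex.mul_re]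
    simp only [Complex.inv_re, Complex.inv_im, hwre, hwim, Complex.normSq_apply]
    norm_num
    rw [show X * X + Y * Y = X ^ 2 + Y ^ 2 by ring]
    field_simp

/-- **Upper Stirling bound**: for `X > 0`, `Y > 0`,
`Re ψ(X+iY) ≤ log Y + X²/(2Y²) − X/(2(X²+Y²)) + (1/(6Y³) + π/(12Y²))`. [cite: Kadiri2005, (Gamma3)] -/
theorem re_digamma_le {X Y : ℝ} (hX : 0 < X) (hY : 0 < Y) :
    (digamma ((X : ℂ) + Y * I)).re ≤
      Real.log Y + X ^ 2 / (2 * Y ^ 2) - X / (2 * (X ^ 2 + Y ^ 2)) + (1 / (6 * Y ^ 3) + π / (12 * Y ^ 2)) := by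
  obtain ⟨h1, h2, h3⟩ := log_norm_bounds hX hY
  have hS := Literature.NumberTheory.LFunctions.Complex.abs_re_digamma_sub_log_norm_add_re_le
    (w := (X : ℂ) + Y * I) (by simp [hX]) (by simp [hY.ne'])
  simp only [Complex.add_im, Complex.ofReal_im, Complex.mul_im, Complex.ofReal_re, Complex.I_im,
    Complex.I_re, mul_one, mul_zero, zero_add, add_zero, abs_of_pos hY] at hS
  rw [h3, abs_le] at hS
  linarith [hS.2]

/-- **Lower Stirling bound**: for `X > 0`, `Y > 0`,
`Re ψ(X+iY) ≥ log Y − X/(2(X²+Y²)) − (1/(6Y³) + π/(12Y²))`. [cite: Kadiri2005, (Gamma3)] -/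
theorem re_digamma_ge {X Y : ℝ} (hX : 0 < X) (hY : 0 < Y) :
    Real.log Y - X / (2 * (X ^ 2 + Y ^ 2)) - (1 / (6 * Y ^ 3) + π / (12 * Y ^ 2)) ≤
      (digamma ((X : ℂ) + Y * I)).re := by
  obtain ⟨h1, h2, h3⟩ := log_norm_bounds hX hY
  have hS := Literature.NumberTheory.LFunctions.Complex.abs_re_digamma_sub_log_norm_add_re_le
    (w := (X : ℂ) + Y * I) (by simp [hX]) (by simp [hY.ne'])
  simp only [Complex.add_im, Complex.ofReal_im, Complex.mul_im, Complex.ofReal_re, Complex.I_im,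
    Complex.I_re, mul_one, mul_zero, zero_add, add_zero, abs_of_pos hY] at hS
  rw [h3, abs_le] at hS
  linarith [hS.1]

/-! ## Kadiri's Lemma 3.5 (large `y`) -/

/-- **Kadiri's Lemma 3.5, case `|y| ≥ y₀`** (her `ψ_{κ,δ}(x,y) ≤ (1−κ) log(y/2) + r₃(x₀,x₁,y₀)`, here
with an explicit pointwise error): for `x > 0`, `δ ≥ 0`, `0 ≤ κ ≤ 1` with `κ(x+δ) ≤ x` and `y ≥ 2`,
`Re ψ(x/2 + iy/2) − κ Re ψ((x+δ)/2 + iy/2) ≤ (1−κ) log(y/2) + x²/(2y²) + (1+κ)(4/(3y³) + π/(3y²))`.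
[cite: Kadiri2005, Lemma 3.5] -/
theorem re_digamma_sub_mul_re_digamma_le {x δ κ y : ℝ} (hx : 0 < x) (hδ : 0 ≤ δ) (hκ0 : 0 ≤ κ)
    (hκx : κ * (x + δ) ≤ x) (hy : 2 ≤ y) :
    (digamma (((x / 2 : ℝ) : ℂ) + ((y / 2 : ℝ) : ℂ) * I)).re -
        κ * (digamma ((((x + δ) / 2 : ℝ) : ℂ) + ((y / 2 : ℝ) : ℂ) * I)).re ≤
      (1 - κ) * Real.log (y / 2) + (x ^ 2 / (2 * y ^ 2) + (1 + κ) * (4 / (3 * y ^ 3) + π / (3 * y ^ 2))) := by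
  set X : ℝ := x / 2 with hX
  set X' : ℝ := (x + δ) / 2 with hX'
  set Y : ℝ := y / 2 with hY
  have hX0 : 0 < X := by rw [hX]; linarith
  have hXX' : X ≤ X' := by rw [hX, hX']; linarith
  have hX'0 : 0 < X' := by linarith
  have hY1 : 1 ≤ Y := by rw [hY]; linarith
  have hY0 : 0 < Y := by linarith
  have hκX : κ * X' ≤ X := by rw [hX, hX']; linarith
  have hup := re_digamma_le hX0 hY0
  have hlo := re_digamma_ge hX'0 hY0
  -- the main-term correction is favourable: `X/(X²+Y²) ≥ κ X'/(X'²+Y²)`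
  have hcorr : κ * (X' / (2 * (X' ^ 2 + Y ^ 2))) ≤ X / (2 * (X ^ 2 + Y ^ 2)) := by
    rw [mul_div_assoc', div_le_div_iff₀ (by positivity) (by positivity)]
    have h1 : κ * X' * (X ^ 2 + Y ^ 2) ≤ X * (X ^ 2 + Y ^ 2) :=
      mul_le_mul_of_nonneg_right hκX (by positivity)
    have h2 : X * (X ^ 2 + Y ^ 2) ≤ X * (X' ^ 2 + Y ^ 2) := by
      refine mul_le_mul_of_nonneg_left ?_ hX0.le
      nlinarith
    nlinarith
  -- the error terms in terms of `y`
  have e1 : X ^ 2 / (2 * Y ^ 2) = x ^ 2 / (2 * y ^ 2) := by rw [hX, hY]; field_simp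
  have e2 : 1 / (6 * Y ^ 3) + π / (12 * Y ^ 2) = 4 / (3 * y ^ 3) + π / (3 * y ^ 2) := by
    rw [hY]; field_simp; ring
  have hE0 : 0 ≤ 1 / (6 * Y ^ 3) + π / (12 * Y ^ 2) := by positivity
  calc (digamma ((X : ℂ) + Y * I)).re - κ * (digamma ((X' : ℂ) + Y * I)).re
      ≤ (Real.log Y + X ^ 2 / (2 * Y ^ 2) - X / (2 * (X ^ 2 + Y ^ 2)) + (1 / (6 * Y ^ 3) + π / (12 * Y ^ 2)))
        - κ * (Real.log Y - X' / (2 * (X' ^ 2 + Y ^ 2)) - (1 / (6 * Y ^ 3) + π / (12 * Y ^ 2))) := by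
        gcongr
    _ = (1 - κ) * Real.log Y + X ^ 2 / (2 * Y ^ 2) + (1 + κ) * (1 / (6 * Y ^ 3) + π / (12 * Y ^ 2))
        - (X / (2 * (X ^ 2 + Y ^ 2)) - κ * (X' / (2 * (X' ^ 2 + Y ^ 2)))) := by ring
    _ ≤ (1 - κ) * Real.log Y + X ^ 2 / (2 * Y ^ 2) + (1 + κ) * (1 / (6 * Y ^ 3) + π / (12 * Y ^ 2)) := by
        linarith
    _ = (1 - κ) * Real.log (y / 2) + (x ^ 2 / (2 * y ^ 2) + (1 + κ) * (4 / (3 * y ^ 3) + π / (3 * y ^ 2))) := by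
        rw [e1, e2]; ring

/-! ## Kadiri's `T₁` and Lemma 4.5 -/

/-- Kadiri's `T₁(s) = −½ log π + ½ Re Γ'/Γ(s/2 + 1)` written out (not a definition: we keep it as
the expression `−(log π)/2 + (Re ψ(s/2+1))/2` of `SmoothedEF.re_fordK_eq_kadiri`). The digamma
argument at `s = σ + it` is `(σ+2)/2 + i t/2`. [folklore] -/
theorem half_add_one_eq (σ t : ℝ) :
    ((σ : ℂ) + t * I) / 2 + 1 = (((σ + 2) / 2 : ℝ) : ℂ) + ((t / 2 : ℝ) : ℂ) * I := by
  push_cast; ring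

/-- **Kadiri's Lemma 4.5, `k ≥ 1`** (Prop. 2.2 termwise; Mossinghoff–Trudgian `c₁(k)`): for
`0 < σ`, `δ ≥ 0`, `0 ≤ κ` with `κ(σ + 2 + δ) ≤ σ + 2`, and `t ≥ 2`,
`T₁(σ+it) − κ T₁(σ+δ+it) ≤ ((1−κ)/2) log t − ((1−κ)/2) log(2π) + ½ r(σ+2, t)`,
`r(x, y) = x²/(2y²) + (1+κ)(4/(3y³) + π/(3y²))`. [cite: Kadiri2005, Lemma 4.5] -/
theorem T1_sub_mul_T1_le {σ δ κ t : ℝ} (hσ : 0 < σ) (hδ : 0 ≤ δ) (hκ0 : 0 ≤ κ)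
    (hκx : κ * (σ + 2 + δ) ≤ σ + 2) (ht : 2 ≤ t) :
    (-(Real.log π) / 2 + (digamma (((σ : ℂ) + t * I) / 2 + 1)).re / 2) -
        κ * (-(Real.log π) / 2 + (digamma ((((σ + δ : ℝ) : ℂ) + t * I) / 2 + 1)).re / 2) ≤
      (1 - κ) / 2 * Real.log t - (1 - κ) / 2 * Real.log (2 * π) +
        (((σ + 2) ^ 2 / (2 * t ^ 2) + (1 + κ) * (4 / (3 * t ^ 3) + π / (3 * t ^ 2)))) / 2 := by
  have h1 := re_digamma_sub_mul_re_digamma_le (x := σ + 2) (δ := δ) (κ := κ) (y := t)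
    (by linarith) hδ hκ0 hκx ht
  rw [half_add_one_eq, half_add_one_eq]
  have e : ((σ + δ + 2) / 2 : ℝ) = ((σ + 2 + δ) / 2 : ℝ) := by ring
  rw [e]
  have hlog : Real.log (t / 2) = Real.log t - Real.log 2 :=
    Real.log_div (by linarith) two_ne_zero
  have hlog2π : Real.log (2 * π) = Real.log 2 + Real.log π :=
    Real.log_mul two_ne_zero Real.pi_ne_zero
  rw [hlog] at h1
  rw [hlog2π]
  linarith

/-! ## The real axis: monotonicity of `ψ` and Lemma 4.5, `k = 0` -/

/-- **`ψ` is non-decreasing on `(0, ∞)`** (from `ψ(w) + γ = Σₖ (1/(k+1) − 1/(w+k))`, termwise).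
[folklore] -/
theorem re_digamma_ofReal_mono {a b : ℝ} (ha : 0 < a) (hab : a ≤ b) :
    (digamma (a : ℂ)).re ≤ (digamma (b : ℂ)).re := by
  have hb : 0 < b := lt_of_lt_of_le ha hab
  have hA := (Literature.Analysis.SpecialFunctions.Complex.hasSum_one_div_sub_one_div_digamma
    (w := (a : ℂ)) (by simp [ha])).mapL Complex.reCLM
  have hB := (Literature.Analysis.SpecialFunctions.Complex.hasSum_one_div_sub_one_div_digamma
    (w := (b : ℂ)) (by simp [hb])).mapL Complex.reCLM
  simp only [Complex.reCLM_apply, Complex.add_re, Complex.ofReal_re] at hA hB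
  have hle := hasSum_le (fun k ↦ ?_) hA hB
  · linarith
  · have hak : (0 : ℝ) < a + k := by positivity
    have hbk : (0 : ℝ) < b + k := by positivity
    have e1 : (1 / ((k : ℂ) + 1) - 1 / ((a : ℂ) + k)).re = 1 / ((k : ℝ) + 1) - 1 / (a + k) := by
      rw [Complex.sub_re, show ((k : ℂ) + 1) = (((k : ℝ) + 1 : ℝ) : ℂ) by push_cast; ring,
        show ((a : ℂ) + k) = ((a + k : ℝ) : ℂ) by push_cast; ring, Complex.div_ofReal_re,
        Complex.div_ofReal_re, Complex.one_re]
    have e2 : (1 / ((k : ℂ) + 1) - 1 / ((b : ℂ) + k)).re = 1 / ((k : ℝ) + 1) - 1 / (b + k) := by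
      rw [Complex.sub_re, show ((k : ℂ) + 1) = (((k : ℝ) + 1 : ℝ) : ℂ) by push_cast; ring,
        show ((b : ℂ) + k) = ((b + k : ℝ) : ℂ) by push_cast; ring, Complex.div_ofReal_re,
        Complex.div_ofReal_re, Complex.one_re]
    rw [e1, e2]
    have : 1 / (b + k) ≤ 1 / (a + (k : ℝ)) := one_div_le_one_div_of_le hak (by linarith)
    linarith

/-- **Kadiri's Lemma 4.5, `k = 0`** (`c₁(0)`): for `0 < σ₀ ≤ σ ≤ 1`, `δ ≥ 0`, `κ ≥ 0`,
`T₁(σ) − κ T₁(σ+δ) ≤ −((1−κ)/2) log π + ½ ψ(3/2) − (κ/2) ψ((σ₀+δ)/2 + 1)` (monotonicity of `ψ`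
on the positive axis). [cite: Kadiri2005, Lemma 4.5] -/
theorem T1_sub_mul_T1_le_zero {σ₀ σ δ κ : ℝ} (hσ₀ : 0 < σ₀) (hσ₀σ : σ₀ ≤ σ) (hσ1 : σ ≤ 1)
    (hδ : 0 ≤ δ) (hκ0 : 0 ≤ κ) :
    (-(Real.log π) / 2 + (digamma ((σ : ℂ) / 2 + 1)).re / 2) -
        κ * (-(Real.log π) / 2 + (digamma (((σ + δ : ℝ) : ℂ) / 2 + 1)).re / 2) ≤
      -((1 - κ) / 2) * Real.log π + (digamma ((3 / 2 : ℝ) : ℂ)).re / 2 -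
        κ / 2 * (digamma ((((σ₀ + δ) / 2 + 1 : ℝ)) : ℂ)).re := by
  have h1 : (digamma ((σ : ℂ) / 2 + 1)).re ≤ (digamma ((3 / 2 : ℝ) : ℂ)).re := by
    rw [show (σ : ℂ) / 2 + 1 = ((σ / 2 + 1 : ℝ) : ℂ) by push_cast; ring]
    exact re_digamma_ofReal_mono (by linarith) (by linarith)
  have h2 : (digamma ((((σ₀ + δ) / 2 + 1 : ℝ)) : ℂ)).re ≤ (digamma (((σ + δ : ℝ) : ℂ) / 2 + 1)).re := by
    rw [show ((σ + δ : ℝ) : ℂ) / 2 + 1 = (((σ + δ) / 2 + 1 : ℝ) : ℂ) by push_cast; ring]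
    exact re_digamma_ofReal_mono (by linarith) (by linarith)
  nlinarith

end KadiriDigamma

end Literature.NumberTheory.LFunctions
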